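import Literature.NumberTheory.Rogawski1990.TransferFactsStabilisation
import Literature.NumberTheory.Rogawski1990.AdelicKappaOrbitalEulerGp
import Literature.NumberTheory.Rogawski1990.PreStabilisationKappaTermsByEndoscopicClass
import HarnessLib

/-!
# The class weights `w[γ̄] = Δ_𝐀(γ_H, γ̄) Δ_∞(γ_H, γ̄_∞)` and `W_{𝒪H}[γ̄] = κ_{𝒪H}(obs γ̄)` of the pre-stabilisation CONSTRUCTED (not posited) from the transfer
# factors and from the stabilisation package (Rogawski 1990, §4.3 (4.3.2)–(4.3.3) pp. 43–44; §5.4 (5.4.2)–(5.4.3) pp. 72–73)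

Topic `NumberTheory/Rogawski1990`; namespace `Literature.NumberTheory.Rogawski1990`; **THEOREMS ONLY** (no definition, no named fact, no instance, no
notation, no `sorry`).  Cell `pub/hodgecm-mathlib`, ENGINE T1 (crux H413 = `stmt-HodgeConjecture-24833`); row «WEIGHTS FROM THE PACKAGE» (A-p06 (g20),
self-placed after ★ ED. 4 `TransferFactsStabilisation` p816075).  HC_CM is proved only modulo the printed citations until rung 0 closes.

WHY.  Every `κ`-side consumer in the tree takes the CLASS WEIGHT as a hypothesis: ★ (E3-G′κ) ∕ G2 §3 read
`(w) (hw : ∀ p : MatchingAdele L H′ γ_H, w ⟦p.adele⟧ = adelicFactor L H′ Δ Tinf.Δ γ_H p)` (print's `Δ_{G∕H}(γ_H, γ̄)` as a function of the `G′(𝐀)`-class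
`⟦γ̄⟧`, [Rogawski1990, §4.3 (4.3.2) p. 43]), and the regular pre-stabilisation spine ★ `PreStabilisationRegularSelf` ∕ ★ `PreStabilisationRegularEndoscopicSide`
reads `(W : I → ConjClasses G′(𝐀) → ℂ) (hW : ∀ i q, W i ⟦q.adele⟧ = (e i)(obs q))` (print's `κ(obs γ)` in (5.4.2)–(5.4.3) p. 72).  Nothing in the tree
CONSTRUCTS these functions.  They exist for a trivial reason — the right-hand sides are `G′(𝐀)`-class functions (★ `adelicFactor_eq_of_isConjAdele`;
for `κ ∘ obs` this follows from the global transfer-factor identity (4.3.3), clause (iv) of ★ ED. 4 `GlobalTransferWithStabilisationPackage`, read on the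
self carrier by ★ `GlobalKappaFormula.apply_obs_eq_adelicFactor_ofSelf`) — and this file discharges the binders once and for all, so that the engine
line's T1b closer (ED ≥ 1.21) writes ONE `obtain ⟨A, _, 𝓡, _, obs, e, hHasse, hκ, W, hW⟩ := …` after pin (xv).

* §1 **`MatchingAdele.exists_weight_eq_adelicFactor`** — `∃ w, ∀ p : MatchingAdele L H′ γ_H, w ⟦p.adele⟧ = adelicFactor L H′ Δ Tinf.Δ γ_H p`.
* §2 **`MatchingAdeleG₂.exists_weights_of_globalKappaFormula`** — from clause (iv) of the package (ED. 4's text VERBATIM) the spine's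
  `∃ W : I(γ₀) → _, ∀ i q, W i ⟦q.adele⟧ = (e i)(obs q)`, `I(γ₀) = {𝒪H // 𝒪H ↦ 𝒪_st(γ₀)}`.
* §3 **`exists_package_weights_of_package`** — the per-class package `∃ (A, 𝓡, obs, e), hHasse ∧ hκ` of ★ ED. 4 (the shape pin (xv) hands the closer at a
  regular `γ₀`) RE-EMITTED with the weights: `∃ (A, 𝓡, obs, e, W), hHasse ∧ hκ ∧ hW` — one `obtain` for the T1b closer.

## References
* [Rogawski1990] J. D. Rogawski, *Automorphic Representations of Unitary Groups in Three Variables*, Ann. of Math. Stud. 123 (1990), §4.3 (4.3.2)–(4.3.3)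
  pp. 43–44, §5.4 (5.4.2)–(5.4.5) pp. 72–74.
* [LanglandsShelstad1987] R. P. Langlands, D. Shelstad, *On the definition of transfer factors*, Math. Ann. 278 (1987), §6.4 Cor. 6.4.B.
* [Kottwitz1986] R. E. Kottwitz, *Stable trace formula: elliptic singular terms*, Math. Ann. 275 (1986), Prop. 7.1, §9.
-/

set_option autoImplicit false

noncomputable section

open MeasureTheory NumberField IsDedekindDomain
open scoped MatrixGroups

namespace Literature.NumberTheory.Rogawski1990

open Literature.NumberTheory.Automorphic
open Literature.AlgebraicGeometry.ShimuraVarieties (unitaryGroup hermForm)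

/-! ## §1 The `E`-κ class weight `w[γ̄] = Δ_𝐀(γ_H, γ̄) · Δ_∞(γ_H ⊗ 1, γ̄_∞)` exists -/

section Weight

variable {L : Type} [Field L] [NumberField L] [IsCMField L] {H' : Matrix (Fin 3) (Fin 3) L}
  {γH : (UnitaryGroup.cmDatum L 2 (Matrix.of fun i j : Fin 2 => if i.val + j.val + 1 = 2 then (1 : L) else 0)).Rational ×
    (UnitaryGroup.cmDatum L 1 (Matrix.of fun i j : Fin 1 => if i.val + j.val + 1 = 1 then (1 : L) else 0)).Rational}

/-- **THE CLASS WEIGHT `w[γ̄] = Δ_𝐀(γ_H, γ̄_f) Δ_∞(γ_H ⊗ 1, γ̄_∞)` EXISTS** as a function on the `G′(𝐀)`-conjugacy classes: the global transfer factor ★ `adelicFactor`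
is constant on `G′(𝐀)`-conjugate matching adèles (★ `adelicFactor_eq_of_isConjAdele`: every `Δ_v` and `Δ_∞` is a class function), so a function `w` on
`ConjClasses G′(𝐀)` reading it on the classes of the matching adèles over `γ_H` exists (value `0` off them) — the binder `hw` of ★
`MatchingAdele.exists_adelicKappaOrbitalIntegralG'_ofLocalAdelic_eq_of_isCanonical` ∕ ★ `AdelicDeltaTransferAssembly` §3, discharged.
[cite: Rogawski1990, §4.3 (4.3.2)–(4.3.3) pp. 43–44] -/
theorem MatchingAdele.exists_weight_eq_adelicFactor (Δ : ∀ v : HeightOneSpectrum (𝓞 ↥(maximalRealSubfield L)), LocalTransferFactor L H' v)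
    (Tinf : ArchTransferFactor L H')
    (γH : (UnitaryGroup.cmDatum L 2 (Matrix.of fun i j : Fin 2 => if i.val + j.val + 1 = 2 then (1 : L) else 0)).Rational ×
      (UnitaryGroup.cmDatum L 1 (Matrix.of fun i j : Fin 1 => if i.val + j.val + 1 = 1 then (1 : L) else 0)).Rational) :
    ∃ w : ConjClasses (UnitaryGroup.cmDatum L 3 H').Adelic → ℂ,
      ∀ p : MatchingAdele L H' γH, w (ConjClasses.mk p.adele) = adelicFactor L H' Δ Tinf.Δ γH p := by
  classical
  refine ⟨fun c => if h : ∃ p : MatchingAdele L H' γH, ConjClasses.mk p.adele = c then adelicFactor L H' Δ Tinf.Δ γH h.choose else 0,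
    fun p => ?_⟩
  have hex : ∃ q : MatchingAdele L H' γH, ConjClasses.mk q.adele = ConjClasses.mk p.adele := ⟨p, rfl⟩
  show (if h : ∃ q : MatchingAdele L H' γH, ConjClasses.mk q.adele = ConjClasses.mk p.adele
      then adelicFactor L H' Δ Tinf.Δ γH h.choose else 0) = adelicFactor L H' Δ Tinf.Δ γH p
  rw [dif_pos hex]
  exact adelicFactor_eq_of_isConjAdele Δ Tinf (ConjClasses.mk_eq_mk_iff_isConj.mp hex.choose_spec)

end Weight

/-! ## §2 The spine's weights `W_{𝒪H}[γ̄] = (e 𝒪H)(obs γ̄)` from clause (iv) of the stabilisation package -/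

section PackageWeights

variable {L : Type} [Field L] [NumberField L] [IsCMField L] {H' : Matrix (Fin 3) (Fin 3) L} {γ₀ : (UnitaryGroup.cmDatum L 3 H').Rational}

/-- **THE SPINE'S CLASS WEIGHTS FROM THE PACKAGE.**  For an obstruction `obs` on the self carrier `𝒞′_𝐀(γ₀)` (★ `MatchingAdeleG₂ L H′ H′ γ₀`), a character
group `𝓡`, the (5.4.5) bijection `e : {𝒪H ∣ 𝒪H ↦ 𝒪_st(γ₀)} ≃ {χ ∈ 𝓡 ∣ χ ≠ 1}` and the global transfer-factor identity (4.3.3) in the shape of clause (iv) of ★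
`GlobalTransferWithStabilisationPackage` (for every norm-paired representative `γ_H → γ₀`, `Δ_𝐀 Δ_∞ = (e ⟦γ_H⟧) ∘ obs ∘ toSelf`), there are class functions
`W 𝒪H` on `ConjClasses G′(𝐀)` with `W 𝒪H ⟦γ̄⟧ = (e 𝒪H)(obs γ̄)` for every `γ̄ ∈ 𝒞′_𝐀(γ₀)` — the binders `(W, hW)` of ★
`adelicStableOrbitalIntegral_stableClassOf_eq_mul_inv_card_mul_of_equiv` (★ `PreStabilisationRegularSelf`) and of ★
`adelicStableOrbitalIntegral_stableClassOf_eq_mul_inv_natCard_add_one_mul_of_globalKappaFormula` (★ `PreStabilisationRegularEndoscopicSide`).  Proof: at the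
representative `γ_H := out 𝒪H` (★ `StableClassH.isNormPair_out_of_transfersTo`) take §1's weight and read (iv) on the self carrier (★
`GlobalKappaFormula.apply_obs_eq_adelicFactor_ofSelf`, ★ `StableClassH.stableClassHOf_out`). [cite: Rogawski1990, §5.4 (5.4.2)–(5.4.5) pp. 72–74; §4.3 (4.3.3) p. 44]
[cite: LanglandsShelstad1987, §6.4 Cor. 6.4.B] -/
theorem MatchingAdeleG₂.exists_weights_of_globalKappaFormula
    (Δ : ∀ v : HeightOneSpectrum (𝓞 ↥(maximalRealSubfield L)), LocalTransferFactor L H' v) (Tinf : ArchTransferFactor L H')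
    {A : Type} [AddCommGroup A] (𝓡 : Subgroup (AddChar A ℂ)) (obs : MatchingAdeleG₂ L H' H' γ₀ → A)
    (e : {𝒪H : StableClassH (cmConjRingHom L) (Matrix.of fun i j : Fin 2 => if i.val + j.val + 1 = 2 then (1 : L) else 0)
            (Matrix.of fun i j : Fin 1 => if i.val + j.val + 1 = 1 then (1 : L) else 0) //
          𝒪H.TransfersTo H' endoForm_antidiagOne (stableClassOf (cmConjRingHom L) H' γ₀)} ≃ {χ : 𝓡 // χ ≠ 1})
    (hκ : ∀ (γH : (UnitaryGroup.cmDatum L 2 (Matrix.of fun i j : Fin 2 => if i.val + j.val + 1 = 2 then (1 : L) else 0)).Rational ×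
          (UnitaryGroup.cmDatum L 1 (Matrix.of fun i j : Fin 1 => if i.val + j.val + 1 = 1 then (1 : L) else 0)).Rational)
        (hγ : IsNormPair L H' γH γ₀),
        GlobalKappaFormula L H' Δ Tinf.Δ (fun p : MatchingAdele L H' γH => obs (MatchingAdele.toSelf hγ p))
          ((e ⟨stableClassHOf (cmConjRingHom L) _ _ γH, hγ⟩).1 : AddChar A ℂ)) :
    ∃ W : {𝒪H : StableClassH (cmConjRingHom L) (Matrix.of fun i j : Fin 2 => if i.val + j.val + 1 = 2 then (1 : L) else 0)
              (Matrix.of fun i j : Fin 1 => if i.val + j.val + 1 = 1 then (1 : L) else 0) //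
            𝒪H.TransfersTo H' endoForm_antidiagOne (stableClassOf (cmConjRingHom L) H' γ₀)} →
        ConjClasses (UnitaryGroup.cmDatum L 3 H').Adelic → ℂ,
      ∀ i (q : MatchingAdeleG₂ L H' H' γ₀), W i (ConjClasses.mk q.adele) = ((e i).1 : AddChar A ℂ) (obs q) := by
  classical
  -- per class, the representative `out i.1` is norm-paired with `γ₀`
  have hγ : ∀ i : {𝒪H : StableClassH (cmConjRingHom L) (Matrix.of fun i j : Fin 2 => if i.val + j.val + 1 = 2 then (1 : L) else 0)
        (Matrix.of fun i j : Fin 1 => if i.val + j.val + 1 = 1 then (1 : L) else 0) //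
      𝒪H.TransfersTo H' endoForm_antidiagOne (stableClassOf (cmConjRingHom L) H' γ₀)},
      IsNormPair L H' (Quotient.out i.1) γ₀ := fun i => StableClassH.isNormPair_out_of_transfersTo i.2
  -- §1's weight at that representative
  choose w hw using fun i : {𝒪H : StableClassH (cmConjRingHom L) (Matrix.of fun i j : Fin 2 => if i.val + j.val + 1 = 2 then (1 : L) else 0)
        (Matrix.of fun i j : Fin 1 => if i.val + j.val + 1 = 1 then (1 : L) else 0) //
      𝒪H.TransfersTo H' endoForm_antidiagOne (stableClassOf (cmConjRingHom L) H' γ₀)} =>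
    MatchingAdele.exists_weight_eq_adelicFactor Δ Tinf (Quotient.out i.1)
  refine ⟨w, fun i q => ?_⟩
  -- the index of the representative's class is `i` itself
  have hi : (⟨stableClassHOf (cmConjRingHom L) _ _ (Quotient.out i.1), hγ i⟩ :
      {𝒪H : StableClassH (cmConjRingHom L) (Matrix.of fun i j : Fin 2 => if i.val + j.val + 1 = 2 then (1 : L) else 0)
          (Matrix.of fun i j : Fin 1 => if i.val + j.val + 1 = 1 then (1 : L) else 0) //
        𝒪H.TransfersTo H' endoForm_antidiagOne (stableClassOf (cmConjRingHom L) H' γ₀)}) = i :=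
    Subtype.ext (StableClassH.stableClassHOf_out i.1)
  have key := GlobalKappaFormula.apply_obs_eq_adelicFactor_ofSelf (hγ i) (hκ (Quotient.out i.1) (hγ i)) q
  calc w i (ConjClasses.mk q.adele)
      = w i (ConjClasses.mk (MatchingAdeleG₂.ofSelf (hγ i) q).adele) := by rw [MatchingAdeleG₂.adele_ofSelf]
    _ = adelicFactor L H' Δ Tinf.Δ (Quotient.out i.1) (MatchingAdeleG₂.ofSelf (hγ i) q) := hw i _
    _ = ((e ⟨stableClassHOf (cmConjRingHom L) _ _ (Quotient.out i.1), hγ i⟩).1 : AddChar A ℂ) (obs q) := key.symm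
    _ = ((e i).1 : AddChar A ℂ) (obs q) := congrArg (fun x => (((e x).1 : AddChar A ℂ) (obs q))) hi

/-! ## §3 The per-class package of ★ ED. 4 re-emitted with its weights -/

/-- **PIN (xv) ⇒ THE CLOSER'S BINDERS IN ONE `obtain`.**  The per-class stabilisation package of ★ `GlobalTransferWithStabilisationPackage` at a regular `γ₀`
(the `∃ (A, 𝓡, obs, e), hHasse ∧ hκ` that the engine line's pin (xv) hands the T1b closer, here for the archimedean factor `Tinf.Δ` of an ★
`ArchTransferFactor`) yields the same data TOGETHER WITH class weights `W` reading `(e 𝒪H) ∘ obs` (§2) — exactly the binder list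
`(𝓡) [Fintype 𝓡] (obs) (e) (hHasse) (hκ) (W) (hW)` of ★ `adelicStableOrbitalIntegral_stableClassOf_eq_mul_inv_natCard_add_one_mul_of_globalKappaFormula`.
[cite: Rogawski1990, §5.4 (5.4.2)–(5.4.5) pp. 72–74; §3.3 Prop. 3.3.1 p. 22; §4.3 (4.3.3) p. 44] [cite: LanglandsShelstad1987, §6.4 Cor. 6.4.B] -/
theorem exists_package_weights_of_package
    {Δ : ∀ v : HeightOneSpectrum (𝓞 ↥(maximalRealSubfield L)), LocalTransferFactor L H' v} (Tinf : ArchTransferFactor L H')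
    (hpkg : ∃ (A : Type) (_ : AddCommGroup A) (𝓡 : Subgroup (AddChar A ℂ)) (_ : Fintype 𝓡) (obs : MatchingAdeleG₂ L H' H' γ₀ → A)
        (e : {𝒪H : StableClassH (cmConjRingHom L) (Matrix.of fun i j : Fin 2 => if i.val + j.val + 1 = 2 then (1 : L) else 0)
            (Matrix.of fun i j : Fin 1 => if i.val + j.val + 1 = 1 then (1 : L) else 0) //
          𝒪H.TransfersTo H' endoForm_antidiagOne (stableClassOf (cmConjRingHom L) H' γ₀)} ≃ {χ : 𝓡 // χ ≠ 1}),
        (∀ p : MatchingAdeleG₂ L H' H' γ₀, (∀ κ ∈ 𝓡, κ (obs p) = 1) ↔ ∃ γ, p.IsRationalOver γ) ∧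
        ∀ (γH : (UnitaryGroup.cmDatum L 2 (Matrix.of fun i j : Fin 2 => if i.val + j.val + 1 = 2 then (1 : L) else 0)).Rational ×
          (UnitaryGroup.cmDatum L 1 (Matrix.of fun i j : Fin 1 => if i.val + j.val + 1 = 1 then (1 : L) else 0)).Rational)
        (hγ : IsNormPair L H' γH γ₀),
          GlobalKappaFormula L H' Δ Tinf.Δ (fun p : MatchingAdele L H' γH => obs (MatchingAdele.toSelf hγ p))
            ((e ⟨stableClassHOf (cmConjRingHom L) _ _ γH, hγ⟩).1 : AddChar A ℂ)) :
    ∃ (A : Type) (_ : AddCommGroup A) (𝓡 : Subgroup (AddChar A ℂ)) (_ : Fintype 𝓡) (obs : MatchingAdeleG₂ L H' H' γ₀ → A)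
        (e : {𝒪H : StableClassH (cmConjRingHom L) (Matrix.of fun i j : Fin 2 => if i.val + j.val + 1 = 2 then (1 : L) else 0)
            (Matrix.of fun i j : Fin 1 => if i.val + j.val + 1 = 1 then (1 : L) else 0) //
          𝒪H.TransfersTo H' endoForm_antidiagOne (stableClassOf (cmConjRingHom L) H' γ₀)} ≃ {χ : 𝓡 // χ ≠ 1})
        (W : {𝒪H : StableClassH (cmConjRingHom L) (Matrix.of fun i j : Fin 2 => if i.val + j.val + 1 = 2 then (1 : L) else 0)
            (Matrix.of fun i j : Fin 1 => if i.val + j.val + 1 = 1 then (1 : L) else 0) //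
          𝒪H.TransfersTo H' endoForm_antidiagOne (stableClassOf (cmConjRingHom L) H' γ₀)} → ConjClasses (UnitaryGroup.cmDatum L 3 H').Adelic → ℂ),
        (∀ p : MatchingAdeleG₂ L H' H' γ₀, (∀ κ ∈ 𝓡, κ (obs p) = 1) ↔ ∃ γ, p.IsRationalOver γ) ∧
        (∀ (γH : (UnitaryGroup.cmDatum L 2 (Matrix.of fun i j : Fin 2 => if i.val + j.val + 1 = 2 then (1 : L) else 0)).Rational ×
          (UnitaryGroup.cmDatum L 1 (Matrix.of fun i j : Fin 1 => if i.val + j.val + 1 = 1 then (1 : L) else 0)).Rational)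
        (hγ : IsNormPair L H' γH γ₀),
          GlobalKappaFormula L H' Δ Tinf.Δ (fun p : MatchingAdele L H' γH => obs (MatchingAdele.toSelf hγ p))
            ((e ⟨stableClassHOf (cmConjRingHom L) _ _ γH, hγ⟩).1 : AddChar A ℂ)) ∧
        ∀ i (q : MatchingAdeleG₂ L H' H' γ₀), W i (ConjClasses.mk q.adele) = ((e i).1 : AddChar A ℂ) (obs q) := by
  obtain ⟨A, _, 𝓡, _, obs, e, hHasse, hκ⟩ := hpkg
  obtain ⟨W, hW⟩ := MatchingAdeleG₂.exists_weights_of_globalKappaFormula Δ Tinf 𝓡 obs e hκ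
  exact ⟨A, inferInstance, 𝓡, inferInstance, obs, e, W, hHasse, hκ, hW⟩

end PackageWeights

end Literature.NumberTheory.Rogawski1990

end
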